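import Literature.IUT.LogVolume.ExplicitEstimatesSzpiroConductorForm
import HarnessLib

/-!
# [ExpEst] Remark 5.3.3, reading-note support: the Legendre curve `E_λ`, `λ = −9/16`, over `ℚ` has a `ℤ`-model
# with ODD discriminant `50625 = 3⁴·5⁴` (so good reduction at `2`) although `|λ|₂ = 16 ≠ 1` — kernel arithmetic
# behind reading note F-1 of `ExplicitEstimatesSzpiroConductorForm.lean` (PROOF-ONLY; nothing asserted about (R0))

`Proofs` file (theorems only; no definitions, no named facts, no instances). S. Mochizuki, I. Fesenko, Y. Hoshi,
A. Minamide, W. Porowski, *Explicit estimates in inter-universal Teichmüller theory*, Kodai Math. J. **45** (2022)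
175–236 [ExpEst; bib `MochizukiEtAl2022`, D-0012 claim key], **Remark 5.3.3**, p. 222 l. 39–42: "we recall that
`N_{L/ℚ}(𝔣_{E_λ}) ≥ rad_L(a,b,c)` [cf. Remark 1.10.1; [Silv1], Chapter III, §1, Proposition 1.7, (b), and its proof;
[Silv2], Chapter IV, §10, Theorem 10.2, (a); … Example 10.5; … Ogg’s Formula 11.1 and its proof]" — the sentence
typed as the HYPOTHESIS predicate `ExpEst.Rmk533RadLeConductor` (never asserted) in the companion file. Its
module docstring and the seat's sheet (`HOME/lit-abc-explicitiut/F29-LOCATOR-FAITHFULNESS.md`, note F-1) record a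
reading of that sentence at `L = ℚ`, `λ = −9/16`, `(a,b,c) = (λ, 1−λ, −1) = (−9/16, 25/16, −1)`. This file supplies
the ELEMENTARY ARITHMETIC of that reading in the kernel, and nothing more:

* `smul_oddModel_eq_legendre_nineSixteenths` — the admissible change of variables `(u; r, s, t) = (2; −1, −1/2, 0)`
  carries the `ℤ`-model `W₀ : y² + xy + y = x³ + x² − 10x − 10` (`⟨1, 1, 1, −10, −10⟩`) to the Legendre equation
  `E_{−9/16} = ⟨0, −(1 + (−9/16)), 0, −9/16, 0⟩`, i.e. `E_{−9/16} ≅_ℚ W₀` (Silverman AEC III.3.1 (b));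
* `Δ_oddModel`, `c₄_oddModel` — `Δ(W₀) = 50625 = 3⁴·5⁴` (odd) and `c₄(W₀) = 481 = 13·37` (prime to `15`);
* `jInv_nineSixteenths` — `j(E_{−9/16}) = 111284641/50625 = 481³/(3⁴·5⁴)` (the tree's `Cor22.jInv`), whose
  denominator is odd;
* `padicValRat_two_nineSixteenths` — `ord₂(λ) = −4 ≠ 0`, i.e. `|λ|₂ = 2⁴ ≠ 1 = |−1|₂`, so the place `2` lies in
  `I_ℚ(λ, 1−λ, −1) = {v : #{|a|_v,|b|_v,|c|_v} ≥ 2}` of Theorem 5.3 and `2 ∣ rad_ℚ(a,b,c)`; likewise `ord₃(λ) = 2`,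
  `ord₅(1−λ) = 2` (`3, 5 ∈ I_ℚ`).

The remaining steps of note F-1 are CLASSICAL and cited, not re-proved here: a `ℤ`-model with `2`-unit
discriminant has good reduction at `2`, so `f₂(E_λ) = 0` (AEC VII.5.1 (a); tree: `WeierstrassCurve.
conductorExponent_eq_zero_iff_holds`); `c₄` a unit and `Δ` a non-unit at `3, 5` give multiplicative reduction
there, `f₃ = f₅ = 1` (AEC VII.5.1 (b); tree: `conductorExponent_eq_one_iff_holds`,
`hasMultiplicativeReductionAt_of_valuation_c₄_eq_one`); whence `N(𝔣_{E_{−9/16}}) = 15` while `2·3·5 = 30 ∣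
rad_ℚ(λ, 1−λ, −1)`. TAKES NO SIDE on [IUTchIII] Cor. 3.12 or on any author; the note concerns one recalled
classical sentence of a side remark and is bookkeeping; no abc / Szpiro claim.
-/

namespace Literature.IUT.LogVolume

namespace ExpEst

open WeierstrassCurve Cor22

/-- `Δ(y² + xy + y = x³ + x² − 10x − 10) = 50625` (`b₂ = 5`, `b₄ = −19`, `b₆ = −39`, `b₈ = −139`).
[cite: SilvermanAEC2009, §III.1 (discriminant formulae)] -/
theorem Δ_oddModel : (⟨1, 1, 1, -10, -10⟩ : WeierstrassCurve ℚ).Δ = 50625 := by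
  simp only [WeierstrassCurve.Δ, WeierstrassCurve.b₂, WeierstrassCurve.b₄, WeierstrassCurve.b₆,
    WeierstrassCurve.b₈]
  norm_num

/-- `50625 = 3⁴·5⁴`; in particular it is odd. [cite: SilvermanAEC2009, §III.1 (discriminant formulae)] -/
theorem Δ_oddModel_eq_pow : (⟨1, 1, 1, -10, -10⟩ : WeierstrassCurve ℚ).Δ = 3 ^ 4 * 5 ^ 4 ∧ ¬ (2 : ℤ) ∣ 50625 := by
  refine ⟨by rw [Δ_oddModel]; norm_num, by decide⟩

/-- `c₄(y² + xy + y = x³ + x² − 10x − 10) = 481 = 13·37` (a unit at `3` and at `5`).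
[cite: SilvermanAEC2009, §III.1 (discriminant formulae)] -/
theorem c₄_oddModel : (⟨1, 1, 1, -10, -10⟩ : WeierstrassCurve ℚ).c₄ = 481 ∧ (481 : ℕ) = 13 * 37 := by
  refine ⟨?_, by norm_num⟩
  simp only [WeierstrassCurve.c₄, WeierstrassCurve.b₂, WeierstrassCurve.b₄]
  norm_num

/-- The `ℤ`-model `W₀ = ⟨1, 1, 1, −10, −10⟩` is an elliptic curve over `ℚ` (`Δ = 50625 ≠ 0`); a theorem, not an
instance. (The same Weierstrass model — the conductor-`15` curve — is `Summit.ABC.ABC.Theorems.isElliptic_fifteen`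
in the summit tree, not importable from `Literature/`; restated here for that reason.)
[cite: SilvermanAEC2009, §III.1 (discriminant formulae)] -/
theorem isElliptic_oddModel : (⟨1, 1, 1, -10, -10⟩ : WeierstrassCurve ℚ).IsElliptic :=
  ⟨isUnit_iff_ne_zero.2 (by rw [Δ_oddModel]; norm_num)⟩

/-- **`E_{−9/16} ≅_ℚ W₀`**: the admissible change of variables `(u; r, s, t) = (2; −1, −1/2, 0)` (i.e. `x = 4x′ − 1`,
`y = 8y′ − 2x′`) carries `W₀ : y² + xy + y = x³ + x² − 10x − 10` to the Legendre equation `y′² = x′(x′−1)(x′ + 9/16)`,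
`λ = −9/16` (the `2`-torsion abscissae `−1, 3, −13/4` of `W₀` have `3 − (−1) = 2²`). Silverman AEC III.3.1 (b)
(isomorphisms of Weierstrass models). [cite: SilvermanAEC2009, Prop. III.3.1 (b)] -/
theorem smul_oddModel_eq_legendre_nineSixteenths :
    (⟨Units.mk0 (2 : ℚ) two_ne_zero, -1, -1 / 2, 0⟩ : VariableChange ℚ) •
        (⟨1, 1, 1, -10, -10⟩ : WeierstrassCurve ℚ) =
      ⟨0, -(1 + (-9 / 16 : ℚ)), 0, -9 / 16, 0⟩ := by
  ext
  · simp only [variableChange_a₁, Units.val_inv_eq_inv_val, Units.val_mk0]; norm_num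
  · simp only [variableChange_a₂, Units.val_inv_eq_inv_val, Units.val_mk0]; norm_num
  · simp only [variableChange_a₃, Units.val_inv_eq_inv_val, Units.val_mk0]; norm_num
  · simp only [variableChange_a₄, Units.val_inv_eq_inv_val, Units.val_mk0]; norm_num
  · simp only [variableChange_a₆, Units.val_inv_eq_inv_val, Units.val_mk0]; norm_num

/-- `j(E_{−9/16}) = 2⁸(λ²−λ+1)³/(λ²(λ−1)²) = 111284641/50625 = 481³/(3⁴·5⁴)` (the tree's `Cor22.jInv`): the
denominator of the `j`-invariant is odd (no `2`), consistent with good reduction of `E_{−9/16}` at `2`.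
[cite: SilvermanAEC2009, Prop. III.1.7 (b)] -/
theorem jInv_nineSixteenths :
    jInv (-9 / 16 : ℚ) = 111284641 / 50625 ∧ (111284641 : ℕ) = 481 ^ 3 ∧ (50625 : ℕ) = 3 ^ 4 * 5 ^ 4 := by
  refine ⟨?_, by norm_num, by norm_num⟩
  rw [jInv]; norm_num

/-- `ord₂(−9/16) = −4` (so `|λ|₂ = 2⁴ ≠ 1 = |−1|₂`: the place `2` belongs to `I_ℚ(λ, 1−λ, −1)` of Theorem 5.3 and
divides `rad_ℚ`), `ord₃(−9/16) = 2` (`3 ∈ I_ℚ`), `ord₅(1 − (−9/16)) = ord₅(25/16) = 2` (`5 ∈ I_ℚ`).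
[cite: MochizukiEtAl2022, Thm 5.3 p. 219 (definition of `I_L`, `rad_L`)] -/
theorem padicValRat_nineSixteenths :
    padicValRat 2 (-9 / 16 : ℚ) = -4 ∧ padicValRat 3 (-9 / 16 : ℚ) = 2 ∧
      padicValRat 5 (1 - (-9 / 16) : ℚ) = 2 := by
  refine ⟨?_, ?_, ?_⟩
  · rw [show (-9 / 16 : ℚ) = (-9 : ℚ) / (16 : ℚ) by norm_num, padicValRat.div (by norm_num) (by norm_num)]
    rw [show (-9 : ℚ) = ((-9 : ℤ) : ℚ) by norm_num, show (16 : ℚ) = ((16 : ℕ) : ℚ) by norm_num,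
      padicValRat.of_int, padicValRat.of_nat]
    have h16 : padicValNat 2 16 = 4 := by
      rw [show (16 : ℕ) = 2 ^ 4 by norm_num, padicValNat.prime_pow]
    have h9 : padicValInt 2 (-9) = 0 := by
      rw [padicValInt.eq_zero_iff]; decide
    rw [h16, h9]; norm_num
  · rw [show (-9 / 16 : ℚ) = (-9 : ℚ) / (16 : ℚ) by norm_num,
      padicValRat.div (p := 3) (by norm_num) (by norm_num)]
    rw [show (-9 : ℚ) = ((-9 : ℤ) : ℚ) by norm_num, show (16 : ℚ) = ((16 : ℕ) : ℚ) by norm_num,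
      padicValRat.of_int, padicValRat.of_nat]
    have h16 : padicValNat 3 16 = 0 := by
      rw [padicValNat.eq_zero_iff]; decide
    have h9 : padicValInt 3 (-9) = 2 := by
      rw [padicValInt, show Int.natAbs (-9) = 3 ^ 2 by norm_num, padicValNat.prime_pow]
    rw [h16, h9]; norm_num
  · haveI : Fact (Nat.Prime 5) := ⟨by norm_num⟩
    rw [show (1 - (-9 / 16) : ℚ) = (25 : ℚ) / (16 : ℚ) by norm_num,
      padicValRat.div (p := 5) (by norm_num) (by norm_num)]
    rw [show (25 : ℚ) = ((25 : ℕ) : ℚ) by norm_num, show (16 : ℚ) = ((16 : ℕ) : ℚ) by norm_num,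
      padicValRat.of_nat, padicValRat.of_nat]
    have h16 : padicValNat 5 16 = 0 := by
      rw [padicValNat.eq_zero_iff]; decide
    have h25 : padicValNat 5 25 = 2 := by
      rw [show (25 : ℕ) = 5 ^ 2 by norm_num, padicValNat.prime_pow]
    rw [h16, h25]; norm_num

end ExpEst

end Literature.IUT.LogVolume
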